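import Summits.CriticalPhenomena.SAWScalingLimit.Theorems.SAWLeftRightFKGFKGToTraversalBoundGateExcisionBubble
import Summits.CriticalPhenomena.SAWScalingLimit.Theorems.SAWLeftRightFKGFKGToTraversalBoundGateExcisionPaths
import Summits.CriticalPhenomena.SAWScalingLimit.Theorems.SAWLeftRightFKGFKGToTraversalBoundDomBounded
import Summits.CriticalPhenomena.SAWScalingLimit.Theses.SAWTotalPositivity
import HarnessLib

/-!
# Gate excision: `CriticalBubbleBound → ∀ w₀, GatedPocketBound w₀` (stub `stub_gateExcision`)

Crux `SAWLeftRightFKG.FKGToTraversalBound` (stmt-CriticalPhenomena-1878), line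
`gates-by-bubble-doors-by-fkg`, registered stub `stub_gateExcision` — the GATE LEMMA (the card's lever):
given the adjacent-pair critical bubble bound, in every carrier of `LeftRightFKG` the critical chord
avoids everything strictly BEHIND a reconnectible throat `T` fitting in one lattice box `Q` of side `w₀`,
outside `Q`, with probability `≥ η(w₀) > 0` — uniformly in the carrier, the mesh and the room behind.

Proof (pure excision + counting; no positive association, no random walk).  Write `Ω_δ` for the graph,
`x = x_c`, `N = (w₀+1)²`, `good = {γ : every behind-site of γ lies in Q}`, `bad = goodᶜ`.
* A bad chord `γ` visits `T` (a behind-site is cut from `a` by `T`), so `γ = P · M · S` at its first and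
  last visits `t₁, t₂` of `T` (`gateExcision_walkDecomp`); the sites of `P ∖ {t₁}` (resp. `S ∖ {t₂}`) are
  joined to `a` (resp. `b`) off `T`, hence are neither in `T` nor behind it.
* SURGERY (`surgery_isPath`): replace `M` by a fixed self-avoiding reconnection `R(t₁,t₂)` inside
  `Q ∩ (T ∪ Behind)` (hypothesis, shortcut by `Walk.bypass`, `|R| ≤ N - 1`); `γ* = P · R · S` is again
  self-avoiding and is GOOD.
* COUNTING (`weight_compl_le`): `γ ↦ (γ*, t₁, t₂, M)` is injective (`append_append_inj_of_isPath`) and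
  `x^{|γ|} ≤ x^{-(N-1)} x^{|γ*|} x^{|M|}`, so
  `Z(bad) ≤ x^{-(N-1)} · Z(good) · Σ_{t,t' ∈ T} Z_Ω(t,t') ≤ x^{-(N-1)} N² (x⁻¹ + C₀)^{N-1} · Z(good)`
  by the splitting induction inside the box (`weight_univ_le_pow_of_inBox`, `card_le_of_inBox`).
* CONCLUSION (`gatedPocketBound_of_twoPoint`, `stub_gateExcision`): `Z = Z(good) + Z(bad) ≤ (1+K) Z(good)`
  with `K = K(x_c, C₀, w₀) < ∞`, `η := (1+K)⁻¹`; the carriers `dom C δ` are bounded (`stub_domBounded`), so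
  `CriticalBubbleBound` supplies `C₀`.
Only theorems; no named fact; axioms are the standard three.
-/

noncomputable section

open MeasureTheory Set
open scoped ENNReal
open Literature.Probability.LatticeModels
open Literature.Probability.RandomPlanarGeometry
open Literature.Probability.RandomPlanarGeometry.SAW
open Summit.CriticalPhenomena.SAWScalingLimit.Theses.SAWLeftRightFKG
open Summit.CriticalPhenomena.SAWScalingLimit.Theses.SAWTotalPositivity (CriticalBubbleBound)
open Summit.CriticalPhenomena.SAWScalingLimit.Theorems.FKGToTraversalBound.Negative (dom lrLE)
open Summit.CriticalPhenomena.SAWScalingLimit.Theorems.FKGToTraversalBound.ExcursionDomination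
  (weight_eq_tsum_indicator isPath_append_iff domainSAW_ext_walk stub_domBounded)

namespace Summit.CriticalPhenomena.SAWScalingLimit.Theorems.FKGToTraversalBound.GatesByBubbleDoorsByFKG

variable {Ω : Set ℂ} {δ : ℝ} {a b : Site 2}

/-! ### Sums of critical weights -/

/-- `w(S) = Σ_{γ ∈ S} x_c^{|γ|}` as a sum over the subtype, with `x_c^{|γ|}` as a power in `ℝ≥0∞`.
[folklore] -/
theorem weight_eq_tsum_subtype (S : Set (DomainSAW Ω δ a b)) :
    weight Ω δ a b S = ∑' γ : S, ENNReal.ofReal criticalFugacity ^ γ.1.length := by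
  rw [weight_eq_tsum_indicator, ← tsum_subtype]
  exact tsum_congr fun γ => ENNReal.ofReal_pow criticalFugacity_pos_lt_one'.1.le _

/-- `Z_Ω(u,v) = Σ_γ x_c^{|γ|}` over all chords, with `x_c^{|γ|}` as a power in `ℝ≥0∞`. [folklore] -/
theorem weight_univ_eq_tsum (u v : Site 2) :
    weight Ω δ u v univ = ∑' γ : DomainSAW Ω δ u v, ENNReal.ofReal criticalFugacity ^ γ.length := by
  rw [weight_eq_tsum_indicator]
  exact tsum_congr fun γ => by
    rw [indicator_of_mem (mem_univ γ), ENNReal.ofReal_pow criticalFugacity_pos_lt_one'.1.le]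

/-- Fubini for a product weight on a product type in `ℝ≥0∞`. [folklore] -/
theorem tsum_prod_mul_eq {α β : Type*} (f : α → ℝ≥0∞) (g : β → ℝ≥0∞) :
    ∑' p : α × β, f p.1 * g p.2 = (∑' x, f x) * ∑' y, g y := by
  calc ∑' p : α × β, f p.1 * g p.2 = ∑' (x) (y), f x * g y :=
        ENNReal.tsum_prod (f := fun x y => f x * g y)
    _ = ∑' x, f x * ∑' y, g y := tsum_congr fun x => ENNReal.tsum_mul_left
    _ = (∑' x, f x) * ∑' y, g y := ENNReal.tsum_mul_right

/-! ### Surgery -/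

/-- A site joined to `a` by a walk of `Ω_δ` off the throat `T` is neither in `T` nor behind `T`.
[folklore] -/
theorem not_behind_of_joined_fst {T : Finset (Site 2)} {y : Site 2}
    (h : ∃ r : (discreteDomainGraph Ω δ).Walk a y, ∀ z ∈ r.support, z ∉ (T : Set (Site 2))) :
    y ∉ T ∧ ¬ Behind Ω δ a b T y := by
  obtain ⟨r, hr⟩ := h
  refine ⟨fun hyT => hr y r.end_mem_support (Finset.mem_coe.2 hyT), fun hB => ?_⟩
  obtain ⟨z, hz, hzT⟩ := hB.1 r
  exact hr z hz (Finset.mem_coe.2 hzT)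

/-- A site joined to `b` by a walk of `Ω_δ` off the throat `T` is neither in `T` nor behind `T`.
[folklore] -/
theorem not_behind_of_joined_snd {T : Finset (Site 2)} {y : Site 2}
    (h : ∃ r : (discreteDomainGraph Ω δ).Walk b y, ∀ z ∈ r.support, z ∉ (T : Set (Site 2))) :
    y ∉ T ∧ ¬ Behind Ω δ a b T y := by
  obtain ⟨r, hr⟩ := h
  refine ⟨fun hyT => hr y r.end_mem_support (Finset.mem_coe.2 hyT), fun hB => ?_⟩
  obtain ⟨z, hz, hzT⟩ := hB.2 r
  exact hr z hz (Finset.mem_coe.2 hzT)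

/-- **Surgery.**  Let `P · M · S` be a self-avoiding walk `a → b` of `Ω_δ` with `P : a → t₁`, `S : t₂ → b`,
the sites of `P ∖ {t₁}` joined to `a` off `T` and the sites of `S ∖ {t₂}` joined to `b` off `T`, and let
`R : t₁ → t₂` be self-avoiding with every site in the box and in `T ∪ Behind`.  Then `P · R · S` is
self-avoiding (sites of `R` are in `T` or behind, sites of `P ∖ {t₁}`, `S ∖ {t₂}` are neither; `P` and
`S` are disjoint pieces of a path) and GOOD: its behind-sites lie on `R`, inside the box. [folklore] -/
theorem surgery_isPath {t₁ t₂ : Site 2} {T : Finset (Site 2)} {q : Site 2} {w₀ : ℕ}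
    {P : (discreteDomainGraph Ω δ).Walk a t₁} {M R : (discreteDomainGraph Ω δ).Walk t₁ t₂}
    {S : (discreteDomainGraph Ω δ).Walk t₂ b}
    (hγ : (P.append (M.append S)).IsPath) (hR : R.IsPath)
    (hRprop : ∀ x ∈ R.support, InBox q w₀ x ∧ (x ∈ T ∨ Behind Ω δ a b T x))
    (hP : ∀ y ∈ P.support, y ≠ t₁ →
      ∃ r : (discreteDomainGraph Ω δ).Walk a y, ∀ z ∈ r.support, z ∉ (T : Set (Site 2)))
    (hS : ∀ y ∈ S.support, y ≠ t₂ →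
      ∃ r : (discreteDomainGraph Ω δ).Walk b y, ∀ z ∈ r.support, z ∉ (T : Set (Site 2))) :
    (P.append (R.append S)).IsPath ∧
      ∀ v ∈ (P.append (R.append S)).support, Behind Ω δ a b T v → InBox q w₀ v := by
  obtain ⟨hPp, hMS, hPMS⟩ := (isPath_append_iff P (M.append S)).1 hγ
  obtain ⟨-, hSp, -⟩ := (isPath_append_iff M S).1 hMS
  have hRS : (R.append S).IsPath := by
    refine (isPath_append_iff R S).2 ⟨hR, hSp, fun x hxS hxR => ?_⟩
    by_contra hne
    obtain ⟨hxT, hxB⟩ := not_behind_of_joined_snd (a := a) (hS x hxS hne)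
    exact (hRprop x hxR).2.elim hxT hxB
  refine ⟨(isPath_append_iff P (R.append S)).2 ⟨hPp, hRS, fun x hx hxP => ?_⟩, fun v hv hB => ?_⟩
  · by_contra hne
    obtain ⟨hxT, hxB⟩ := not_behind_of_joined_fst (b := b) (hP x hxP hne)
    rcases (SimpleGraph.Walk.mem_support_append_iff _ _).1 hx with hxR | hxS
    · exact (hRprop x hxR).2.elim hxT hxB
    · exact hne (hPMS x ((SimpleGraph.Walk.mem_support_append_iff _ _).2 (Or.inr hxS)) hxP)
  · rcases (SimpleGraph.Walk.mem_support_append_iff _ _).1 hv with hvP | hvRS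
    · by_cases hvt : v = t₁
      · subst hvt
        exact (hRprop _ R.start_mem_support).1
      · exact absurd hB (not_behind_of_joined_fst (hP v hvP hvt)).2
    · rcases (SimpleGraph.Walk.mem_support_append_iff _ _).1 hvRS with hvR | hvS
      · exact (hRprop v hvR).1
      · by_cases hvt : v = t₂
        · subst hvt
          exact (hRprop _ R.end_mem_support).1
        · exact absurd hB (not_behind_of_joined_snd (hS v hvS hvt)).2

/-- **Injectivity bookkeeping of the excision map** `P · M · S ↦ (P · R(i) · S, i, M)`, where the middle
piece is replaced by a fixed walk `R i` depending only on the index `i` (the pair of throat sites): equal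
images have equal preimages (`append_append_inj_of_isPath`). [folklore] -/
theorem excision_inj_aux {ι : Type*} (e₁ e₂ : ι → Site 2)
    (R : ∀ i, (discreteDomainGraph Ω δ).Walk (e₁ i) (e₂ i)) {i i' : ι} (hii' : i = i')
    {P : (discreteDomainGraph Ω δ).Walk a (e₁ i)} {M : (discreteDomainGraph Ω δ).Walk (e₁ i) (e₂ i)}
    {S : (discreteDomainGraph Ω δ).Walk (e₂ i) b}
    {P' : (discreteDomainGraph Ω δ).Walk a (e₁ i')} {M' : (discreteDomainGraph Ω δ).Walk (e₁ i') (e₂ i')}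
    {S' : (discreteDomainGraph Ω δ).Walk (e₂ i') b}
    (hP : P.IsPath) (hP' : P'.IsPath) {hMp : M.IsPath} {hMp' : M'.IsPath}
    (hM : HEq (⟨M, hMp⟩ : DomainSAW Ω δ (e₁ i) (e₂ i)) (⟨M', hMp'⟩ : DomainSAW Ω δ (e₁ i') (e₂ i')))
    (h : P.append ((R i).append S) = P'.append ((R i').append S')) :
    P.append (M.append S) = P'.append (M'.append S') := by
  subst hii'
  obtain ⟨rfl, rfl⟩ := append_append_inj_of_isPath hP hP' h
  have hMM' : M = M' := congrArg DomainSAW.walk (eq_of_heq hM)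
  rw [hMM']

/-! ### Counting: the weight of the bad chords -/

/-- **Excision estimate.**  If every pair of lattice neighbours has two-point function `≤ C₀` in `Ω_δ`,
the throat `T` lies in the box `InBox q w₀` and is reconnectible inside the box through `T ∪ Behind`,
then, with `N = (w₀+1)²`,
`w(bad) ≤ x_c^{-(N-1)} · (N² (x_c⁻¹ + C₀)^{N-1}) · w(good)`,
`good = {γ | every behind-site of γ is in the box}`, `bad = goodᶜ`: decomposition at the first/last
visits of `T`, surgery, injectivity of `γ ↦ (γ*, t₁, t₂, M)` and the two-point bound inside the box.
[folklore] -/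
theorem weight_compl_le {C₀ : ℝ≥0∞}
    (hbub : ∀ u v : Site 2, (zdGraph 2).Adj u v → weight Ω δ u v univ ≤ C₀)
    (T : Finset (Site 2)) (q : Site 2) (w₀ : ℕ) (hT : ∀ t ∈ T, InBox q w₀ t)
    (hrec : ∀ t ∈ T, ∀ t' ∈ T, ∃ p : (discreteDomainGraph Ω δ).Walk t t',
      ∀ x ∈ p.support, InBox q w₀ x ∧ (x ∈ T ∨ Behind Ω δ a b T x)) :
    weight Ω δ a b {γ | ∀ v ∈ γ.walk.support, Behind Ω δ a b T v → InBox q w₀ v}ᶜ ≤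
      (ENNReal.ofReal criticalFugacity)⁻¹ ^ ((w₀ + 1) ^ 2 - 1) *
        ((((w₀ + 1) ^ 2 : ℕ) : ℝ≥0∞) ^ 2 *
          ((ENNReal.ofReal criticalFugacity)⁻¹ + C₀) ^ ((w₀ + 1) ^ 2 - 1)) *
        weight Ω δ a b {γ | ∀ v ∈ γ.walk.support, Behind Ω δ a b T v → InBox q w₀ v} := by
  classical
  set c : ℝ≥0∞ := ENNReal.ofReal criticalFugacity with hc
  set N : ℕ := (w₀ + 1) ^ 2 with hN
  set K₁ : ℝ≥0∞ := (c⁻¹ + C₀) ^ (N - 1) with hK₁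
  set good : Set (DomainSAW Ω δ a b) :=
    {γ | ∀ v ∈ γ.walk.support, Behind Ω δ a b T v → InBox q w₀ v} with hgood
  have hc0 : c ≠ 0 := (ENNReal.ofReal_pos.2 criticalFugacity_pos_lt_one'.1).ne'
  have hctop : c ≠ ⊤ := ENNReal.ofReal_ne_top
  have hc1 : c ≤ 1 := ENNReal.ofReal_le_one.2 criticalFugacity_pos_lt_one'.2.le
  -- (1) canonical self-avoiding reconnections inside the box
  have hR : ∀ tt : ↥T × ↥T, ∃ R : (discreteDomainGraph Ω δ).Walk tt.1 tt.2, R.IsPath ∧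
      R.length ≤ N - 1 ∧ ∀ x ∈ R.support, InBox q w₀ x ∧ (x ∈ T ∨ Behind Ω δ a b T x) := by
    rintro ⟨⟨t, ht⟩, ⟨t', ht'⟩⟩
    obtain ⟨p, hp⟩ := hrec t ht t' ht'
    exact ⟨p.bypass, p.bypass_isPath,
      length_le_of_isPath_inBox p.bypass_isPath
        fun x hx => (hp x (p.support_bypass_subset_support hx)).1,
      fun x hx => hp x (p.support_bypass_subset_support hx)⟩
  choose R hRpath hRlen hRprop using hR
  -- (2) decomposition of the bad chords at the first and last visits of the throat
  have hdec : ∀ γ : ↥goodᶜ, ∃ (t₁ t₂ : Site 2) (P : (discreteDomainGraph Ω δ).Walk a t₁)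
      (M : (discreteDomainGraph Ω δ).Walk t₁ t₂) (S : (discreteDomainGraph Ω δ).Walk t₂ b),
      γ.1.walk = P.append (M.append S) ∧ t₁ ∈ (T : Set (Site 2)) ∧ t₂ ∈ (T : Set (Site 2)) ∧
      (∀ y ∈ P.support, y ≠ t₁ →
        ∃ r : (discreteDomainGraph Ω δ).Walk a y, ∀ z ∈ r.support, z ∉ (T : Set (Site 2))) ∧
      (∀ y ∈ S.support, y ≠ t₂ →
        ∃ r : (discreteDomainGraph Ω δ).Walk b y, ∀ z ∈ r.support, z ∉ (T : Set (Site 2))) := by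
    rintro ⟨γ, hγ⟩
    refine gateExcision_walkDecomp (T : Set (Site 2)) γ.walk ?_
    have hγ' : ¬ ∀ v ∈ γ.walk.support, Behind Ω δ a b T v → InBox q w₀ v := hγ
    push Not at hγ'
    obtain ⟨v, hv, hBv, -⟩ := hγ'
    obtain ⟨y, hy, hyT⟩ := hBv.1 (γ.walk.takeUntil v hv)
    exact ⟨y, γ.walk.support_takeUntil_subset_support hv hy, Finset.mem_coe.2 hyT⟩
  choose t₁ t₂ P M S hwalk ht₁ ht₂ hP hS using hdec
  have hγpath : ∀ γ : ↥goodᶜ, ((P γ).append ((M γ).append (S γ))).IsPath := fun γ => by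
    rw [← hwalk γ]
    exact γ.1.isPath
  have hPpath : ∀ γ : ↥goodᶜ, (P γ).IsPath := fun γ => (hγpath γ).of_append_left
  have hMpath : ∀ γ : ↥goodᶜ, (M γ).IsPath := fun γ => (hγpath γ).of_append_right.of_append_left
  -- the pair of throat sites of a bad chord
  let tt : ↥goodᶜ → ↥T × ↥T := fun γ =>
    (⟨t₁ γ, Finset.mem_coe.1 (ht₁ γ)⟩, ⟨t₂ γ, Finset.mem_coe.1 (ht₂ γ)⟩)
  -- (3) surgery
  have hsurg : ∀ γ : ↥goodᶜ, ((P γ).append ((R (tt γ)).append (S γ))).IsPath ∧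
      ∀ v ∈ ((P γ).append ((R (tt γ)).append (S γ))).support,
        Behind Ω δ a b T v → InBox q w₀ v :=
    fun γ => surgery_isPath (hγpath γ) (hRpath (tt γ)) (hRprop (tt γ)) (hP γ) (hS γ)
  -- (4) the excision map and its injectivity
  let Φ : ↥goodᶜ → ↥good × Σ tt : ↥T × ↥T, DomainSAW Ω δ tt.1 tt.2 := fun γ =>
    (⟨⟨(P γ).append ((R (tt γ)).append (S γ)), (hsurg γ).1⟩, (hsurg γ).2⟩,
      ⟨tt γ, ⟨M γ, hMpath γ⟩⟩)
  have hΦ : Function.Injective Φ := by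
    intro γ γ' h
    have h1 : (P γ).append ((R (tt γ)).append (S γ)) = (P γ').append ((R (tt γ')).append (S γ')) :=
      congrArg (fun y => y.1.1.walk) h
    have h2 : (⟨tt γ, ⟨M γ, hMpath γ⟩⟩ : Σ tt : ↥T × ↥T, DomainSAW Ω δ tt.1 tt.2) =
        ⟨tt γ', ⟨M γ', hMpath γ'⟩⟩ := congrArg (fun y => y.2) h
    obtain ⟨htt', hMM'⟩ := Sigma.mk.inj_iff.1 h2
    apply Subtype.ext
    apply domainSAW_ext_walk
    rw [hwalk γ, hwalk γ']
    exact excision_inj_aux (fun tt : ↥T × ↥T => (tt.1 : Site 2)) (fun tt : ↥T × ↥T => (tt.2 : Site 2))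
      R htt' (hPpath γ) (hPpath γ') hMM' h1
  -- (5) pointwise comparison of the weights
  have hptw : ∀ γ : ↥goodᶜ, c ^ γ.1.length ≤
      c⁻¹ ^ (N - 1) * (c ^ (Φ γ).1.1.length * c ^ (Φ γ).2.2.length) := by
    intro γ
    have hlenγ : γ.1.length = (P γ).length + ((M γ).length + (S γ).length) := by
      rw [DomainSAW.length, hwalk γ, SimpleGraph.Walk.length_append, SimpleGraph.Walk.length_append]
    have hlen1 : (Φ γ).1.1.length = (P γ).length + ((R (tt γ)).length + (S γ).length) := by
      show ((P γ).append ((R (tt γ)).append (S γ))).length = _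
      rw [SimpleGraph.Walk.length_append, SimpleGraph.Walk.length_append]
    have hlen2 : (Φ γ).2.2.length = (M γ).length := rfl
    have hunit : 1 ≤ c⁻¹ ^ (N - 1) * c ^ (R (tt γ)).length :=
      calc (1 : ℝ≥0∞) = (c⁻¹ * c) ^ (N - 1) := by rw [ENNReal.inv_mul_cancel hc0 hctop, one_pow]
        _ = c⁻¹ ^ (N - 1) * c ^ (N - 1) := mul_pow _ _ _
        _ ≤ c⁻¹ ^ (N - 1) * c ^ (R (tt γ)).length :=
            mul_le_mul_right (pow_le_pow_of_le_one zero_le hc1 (hRlen (tt γ))) _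
    rw [hlenγ, hlen1, hlen2]
    calc c ^ ((P γ).length + ((M γ).length + (S γ).length))
        = 1 * c ^ ((P γ).length + ((M γ).length + (S γ).length)) := (one_mul _).symm
      _ ≤ (c⁻¹ ^ (N - 1) * c ^ (R (tt γ)).length) *
            c ^ ((P γ).length + ((M γ).length + (S γ).length)) := mul_le_mul_left hunit _
      _ = c⁻¹ ^ (N - 1) * (c ^ ((P γ).length + ((R (tt γ)).length + (S γ).length)) *
            c ^ (M γ).length) := by ring
  -- (6) the fibre mass: Σ_{t,t' ∈ T} Z_Ω(t,t') ≤ N² K₁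
  have hsigma : ∑' s : (Σ tt : ↥T × ↥T, DomainSAW Ω δ tt.1 tt.2), c ^ s.2.length ≤
      (N : ℝ≥0∞) ^ 2 * K₁ :=
    calc ∑' s : (Σ tt : ↥T × ↥T, DomainSAW Ω δ tt.1 tt.2), c ^ s.2.length
        = ∑' (tt : ↥T × ↥T) (m : DomainSAW Ω δ tt.1 tt.2), c ^ m.length := ENNReal.tsum_sigma' _
      _ = ∑' tt : ↥T × ↥T, weight Ω δ tt.1 tt.2 univ :=
          tsum_congr fun tt => (weight_univ_eq_tsum _ _).symm
      _ ≤ ∑' _tt : ↥T × ↥T, K₁ := by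
          refine ENNReal.tsum_le_tsum fun tt => ?_
          obtain ⟨p, hp⟩ := hrec _ tt.1.2 _ tt.2.2
          exact weight_univ_le_pow_of_inBox hbub p fun x hx => (hp x hx).1
      _ = (Fintype.card (↥T × ↥T) : ℝ≥0∞) * K₁ := by
          rw [tsum_fintype, Finset.sum_const, Finset.card_univ, nsmul_eq_mul]
      _ ≤ (N : ℝ≥0∞) ^ 2 * K₁ := by
          refine mul_le_mul_left ?_ _
          have hcard : Fintype.card (↥T × ↥T) ≤ N ^ 2 := by
            rw [Fintype.card_prod, Fintype.card_coe, sq]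
            exact Nat.mul_le_mul (card_le_of_inBox hT) (card_le_of_inBox hT)
          exact_mod_cast hcard
  -- (7) assemble
  calc weight Ω δ a b goodᶜ
      = ∑' γ : ↥goodᶜ, c ^ γ.1.length := weight_eq_tsum_subtype _
    _ ≤ ∑' γ : ↥goodᶜ, c⁻¹ ^ (N - 1) * (c ^ (Φ γ).1.1.length * c ^ (Φ γ).2.2.length) :=
        ENNReal.tsum_le_tsum hptw
    _ = c⁻¹ ^ (N - 1) * ∑' γ : ↥goodᶜ,
          (fun y : ↥good × Σ tt : ↥T × ↥T, DomainSAW Ω δ tt.1 tt.2 =>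
            c ^ y.1.1.length * c ^ y.2.2.length) (Φ γ) := by
        rw [ENNReal.tsum_mul_left]
    _ ≤ c⁻¹ ^ (N - 1) * ∑' y : ↥good × Σ tt : ↥T × ↥T, DomainSAW Ω δ tt.1 tt.2,
          c ^ y.1.1.length * c ^ y.2.2.length :=
        mul_le_mul_right (ENNReal.tsum_comp_le_tsum_of_injective hΦ _) _
    _ = c⁻¹ ^ (N - 1) * ((∑' g : ↥good, c ^ g.1.length) *
          ∑' s : (Σ tt : ↥T × ↥T, DomainSAW Ω δ tt.1 tt.2), c ^ s.2.length) := by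
        rw [tsum_prod_mul_eq (fun g : ↥good => c ^ g.1.length)
          (fun s : (Σ tt : ↥T × ↥T, DomainSAW Ω δ tt.1 tt.2) => c ^ s.2.length)]
    _ ≤ c⁻¹ ^ (N - 1) * (weight Ω δ a b good * ((N : ℝ≥0∞) ^ 2 * K₁)) := by
        rw [← weight_eq_tsum_subtype good]
        exact mul_le_mul_right (mul_le_mul_right hsigma _) _
    _ = c⁻¹ ^ (N - 1) * ((N : ℝ≥0∞) ^ 2 * K₁) * weight Ω δ a b good := by ring

/-! ### Conclusion -/

/-- **Gated pocket bound from the two-point hypothesis** (core of the gate lemma, with the carrier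
abstracted): for `C₀ < ∞` and `w₀` there is `η = η(C₀, w₀) > 0` such that in EVERY discrete domain `Ω_δ`
whose lattice-neighbour two-point functions are `≤ C₀`, for every throat `T` in a box of side `w₀`
reconnectible inside the box through `T ∪ Behind`, `η · Z(a,b) ≤ w(good)`.  `η := (1 + K)⁻¹` with the
constant `K` of `weight_compl_le` and `Z = w(good) + w(bad)`. [folklore] -/
theorem gatedPocketBound_of_twoPoint {C₀ : ℝ≥0∞} (hC₀ : C₀ ≠ ⊤) (w₀ : ℕ) :
    ∃ η : ℝ, 0 < η ∧ ∀ (Ω : Set ℂ) (δ : ℝ) (a b : Site 2) (T : Finset (Site 2)) (q : Site 2),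
      (∀ u v : Site 2, (zdGraph 2).Adj u v → weight Ω δ u v univ ≤ C₀) →
      (∀ t ∈ T, InBox q w₀ t) →
      (∀ t ∈ T, ∀ t' ∈ T, ∃ p : (discreteDomainGraph Ω δ).Walk t t',
        ∀ x ∈ p.support, InBox q w₀ x ∧ (x ∈ T ∨ Behind Ω δ a b T x)) →
      ENNReal.ofReal η * weight Ω δ a b univ ≤
        weight Ω δ a b {γ | ∀ v ∈ γ.walk.support, Behind Ω δ a b T v → InBox q w₀ v} := by
  set c : ℝ≥0∞ := ENNReal.ofReal criticalFugacity with hc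
  set K : ℝ≥0∞ := c⁻¹ ^ ((w₀ + 1) ^ 2 - 1) *
    ((((w₀ + 1) ^ 2 : ℕ) : ℝ≥0∞) ^ 2 * (c⁻¹ + C₀) ^ ((w₀ + 1) ^ 2 - 1)) with hK
  have hc0 : c ≠ 0 := (ENNReal.ofReal_pos.2 criticalFugacity_pos_lt_one'.1).ne'
  have hcinv : c⁻¹ ≠ ⊤ := ENNReal.inv_ne_top.2 hc0
  have hKtop : K ≠ ⊤ :=
    ENNReal.mul_ne_top (ENNReal.pow_ne_top hcinv)
      (ENNReal.mul_ne_top (ENNReal.pow_ne_top (ENNReal.natCast_ne_top _))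
        (ENNReal.pow_ne_top (ENNReal.add_ne_top.2 ⟨hcinv, hC₀⟩)))
  have h1Ktop : 1 + K ≠ ⊤ := ENNReal.add_ne_top.2 ⟨ENNReal.one_ne_top, hKtop⟩
  have h1K0 : 1 + K ≠ 0 := by simp
  refine ⟨((1 + K).toReal)⁻¹, inv_pos.2 (ENNReal.toReal_pos h1K0 h1Ktop), ?_⟩
  intro Ω δ a b T q hbub hT hrec
  have hbad := weight_compl_le (a := a) (b := b) hbub T q w₀ hT hrec
  have hη : ENNReal.ofReal ((1 + K).toReal)⁻¹ * (1 + K) = 1 := by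
    rw [ENNReal.ofReal_inv_of_pos (ENNReal.toReal_pos h1K0 h1Ktop), ENNReal.ofReal_toReal h1Ktop,
      ENNReal.inv_mul_cancel h1K0 h1Ktop]
  calc ENNReal.ofReal ((1 + K).toReal)⁻¹ * weight Ω δ a b univ
      = ENNReal.ofReal ((1 + K).toReal)⁻¹ *
          (weight Ω δ a b {γ | ∀ v ∈ γ.walk.support, Behind Ω δ a b T v → InBox q w₀ v} +
            weight Ω δ a b {γ | ∀ v ∈ γ.walk.support, Behind Ω δ a b T v → InBox q w₀ v}ᶜ) := by
        rw [measure_add_measure_compl (MeasurableSpace.measurableSet_top)]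
    _ ≤ ENNReal.ofReal ((1 + K).toReal)⁻¹ *
          (weight Ω δ a b {γ | ∀ v ∈ γ.walk.support, Behind Ω δ a b T v → InBox q w₀ v} +
            K * weight Ω δ a b {γ | ∀ v ∈ γ.walk.support, Behind Ω δ a b T v → InBox q w₀ v}) := by
        gcongr
    _ = ENNReal.ofReal ((1 + K).toReal)⁻¹ * (1 + K) *
          weight Ω δ a b {γ | ∀ v ∈ γ.walk.support, Behind Ω δ a b T v → InBox q w₀ v} := by ring
    _ = weight Ω δ a b {γ | ∀ v ∈ γ.walk.support, Behind Ω δ a b T v → InBox q w₀ v} := by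
        rw [hη, one_mul]

/-- **Registered stub `stub_gateExcision`** (crux stmt-CriticalPhenomena-1878, line
`gates-by-bubble-doors-by-fkg`): **the critical bubble bound implies the gated pocket bound at every
throat size.**  The carriers `dom C δ` of `LeftRightFKG` are bounded (`stub_domBounded`), so
`CriticalBubbleBound` bounds every lattice-neighbour two-point function of `(dom C δ)_δ` by its constant
`C₀ < ∞`, and `gatedPocketBound_of_twoPoint` applies (its `η` depends on `C₀, w₀` only). [folklore] -/
theorem stub_gateExcision : CriticalBubbleBound → ∀ w₀ : ℕ, GatedPocketBound w₀ := by
  rintro ⟨C₀, hC₀, hbub⟩ w₀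
  obtain ⟨η, hη, H⟩ := gatedPocketBound_of_twoPoint hC₀ w₀
  refine ⟨η, hη, ?_⟩
  intro δ c a b a' b' C hδ _ _ _ _ T q _ _ hT hrec
  exact H (dom C δ) δ a b T q (fun u v huv => hbub (dom C δ) δ u v (stub_domBounded c C δ) hδ huv)
    (fun t ht => (hT t ht).2) hrec

end Summit.CriticalPhenomena.SAWScalingLimit.Theorems.FKGToTraversalBound.GatesByBubbleDoorsByFKG

end
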